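import Literature.AlgebraicGeometry.Resolution.LinearProjection
import Literature.AlgebraicGeometry.Resolution.Lemma411FormsProjection
import Literature.AlgebraicGeometry.Resolution.Lemma411EtaleOverVertex
import Literature.AlgebraicGeometry.Motives.ToProjFunctionField
import Literature.AlgebraicGeometry.Motives.FiberStalk
import HarnessLib

/-!
# The linear projection over the vertex: `π^*(yₐ/y_{d+1}) = tₐ/t_{d+1}`, the fibre, étaleness

Topic: `Literature/AlgebraicGeometry/Resolution`. For the linear projection
`π = (t₀ : … : t_{d+1}) : X → ℙ^{d+1}_k` of a closed subscheme `X ⊆ ℙ^N_k` defined by `d + 2`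
linear forms without common zero (`LinearProjection`), and the vertex
`p = (0 : … : 0 : 1)` of `ℙ^{d+1}` (`DeJong1996.vertex`, the normalisation used by the open
leaf `DeJong1996Lemma411VertexChoice` of de Jong 1996, proof of Lemma 4.11, p. 68):

* `LinSec.proj_eq_vertex_iff` — **`π(x) = p ↔ x ∈ X ∩ V(t₀, …, t_d)`**;
* `LinSec.stalkMap_proj_germ_sec` — **`π^*(yₐ/y_j) = tₐ/t_j` on germs** (the tree's
  `GeneratingSections.app_sec`, as in the sibling `Lemma411FormsProjection` for forms of
  higher degree), and `germ_lsRatio_mul_germ_linSec`: `(tₐ/t_j) · (t_j/x_h) = tₐ/x_h` in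
  `𝒪_{X,x}`;
* `LinSec.map_maximalIdeal_proj` — **for `π(x) = p`: `𝔪_p · 𝒪_{X,x} = (t₀, …, t_d)_x`**, the cut
  ideal `LinSec.cutIdeal` of the first `d + 1` forms;
* `LinSec.isReduced_fiber_vertex` — hence **the scheme-theoretic fibre `π⁻¹(p)` is reduced as
  soon as `(t₀, …, t_d)_x = 𝔪_x` at every point over `p`** (`Motives.nonempty_stalkFiber_ringEquiv`),
  and then (`exists_etale_morphismRestrict_proj_vertex`, through the sibling's
  `DeJong1996.exists_etale_morphismRestrict_vertex_of_isReduced_fiber`: Matsumura 23.1 +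
  EGA IV₄ 17.6.1) **`π` is étale over a neighbourhood of `p`** — the clause "`p ∉ B`" of
  `DeJong1996.Lemma411Projection`.

Everything is proved; no named facts.

## References

* A. J. de Jong, *Smoothness, semi-stability and alterations*, Publ. Math. IHÉS 83 (1996),
  proof of Lemma 4.11, p. 68. [DeJong1996]
* R. Hartshorne, *Algebraic Geometry* (1977), II Thm. 7.1 ("`s_i = φ^*(x_i)`"). [Hartshorne1977]
-/

noncomputable section

open CategoryTheory CategoryTheory.Limits AlgebraicGeometry TopologicalSpace Opposite
  HomogeneousLocalization IsLocalRing
open Literature.AlgebraicGeometry.Morphisms.ProjCech (grading PP)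
open Literature.AlgebraicGeometry.Motives
open Literature.AlgebraicGeometry.Motives.ProjFrac
open Literature.AlgebraicGeometry.Motives.RatFn

attribute [local instance] MvPolynomial.gradedAlgebra
  Literature.AlgebraicGeometry.Motives.ProjBaseChange.algebraBase

namespace Literature.AlgebraicGeometry.Resolution

universe u

namespace LinSec

open DeJong1996

variable {k : Type u} [Field k] {N : ℕ} {X : Scheme.{u}} [IsIntegral X] (ι : X ⟶ PP k N)
variable {d : ℕ} (t : Fin (d + 1 + 1) → Fin (N + 1) → k) (f : X ⟶ Spec (.of k))
  (hbpf : NoCommonZero ι t)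

/-- The first `d + 1` of the `d + 2` forms. [folklore] -/
abbrev tInit : Fin (d + 1) → Fin (N + 1) → k := fun i => t (Fin.castSucc i)

/-! ## The fibre over the vertex, set-theoretically -/

/-- **`π(x)` is the vertex iff `x` is a common zero of `t₀, …, t_d`.** [folklore] -/
theorem proj_eq_vertex_iff (x : X) :
    proj ι t f hbpf x = vertex d k ↔ x ∈ cutSet ι (tInit t) := by
  rw [eq_vertex_iff]
  simp only [cutSet, Set.mem_iInter, tInit]
  refine forall_congr' fun i => ?_
  rw [← not_iff_not, ← Proj.mem_basicOpen (grading k (d + 1)), proj_apply_mem_basicOpen_iff]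

/-- A point over the vertex is not on `V(t_{d+1})`. [folklore] -/
theorem notMem_hyp_last_of_proj_eq_vertex {x : X} (hx : proj ι t f hbpf x = vertex d k) :
    x ∉ hyp ι (t (Fin.last (d + 1))) := by
  rw [← proj_apply_mem_basicOpen_iff ι t f hbpf, hx]
  exact vertex_mem_basicOpen_last d k

/-- A point over the vertex lies in the last chart `X_{t_{d+1}}` of the linear system.
[folklore] -/
theorem mem_lsChart_last_of_proj_eq_vertex {x : X} (hx : proj ι t f hbpf x = vertex d k) :
    x ∈ lsChart (formVec ι t) (Fin.last (d + 1)) :=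
  mem_lsChart_of_notMem_hyp ι (notMem_hyp_last_of_proj_eq_vertex ι t f hbpf hx)

/-- `vertex ∉ π(Z)` as soon as `t₀, …, t_d` have no common zero on `Z`. [folklore] -/
theorem vertex_notMem_image_proj {Z : Set X} (hZ : ∀ z ∈ Z, z ∉ cutSet ι (tInit t)) :
    vertex d k ∉ proj ι t f hbpf '' Z := by
  rintro ⟨z, hz, hzv⟩
  exact hZ z hz ((proj_eq_vertex_iff ι t f hbpf z).mp hzv)

/-! ## `π^*(yₐ/y_j) = tₐ/t_j` -/

/-- **`π^*(yₐ/y_j) = tₐ/t_j` on germs**: the stalk map of `π` at `x` sends the germ at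
`π(x) ∈ D₊(y_j)` of the coordinate section `yₐ/y_j` to the germ at `x` of the ratio
`tₐ/t_j ∈ Γ(X_{t_j}, 𝒪_X)` of the linear system. [cite: Hartshorne1977, II Thm. 7.1] -/
theorem stalkMap_proj_germ_sec {x : X} (j : Fin (d + 1 + 1))
    (hxP : proj ι t f hbpf x ∈ (ProjSpace.U j : (ProjSpace.P (d + 1) k).Opens))
    (hxU : x ∈ lsChart (formVec ι t) j) (a : Fin (d + 1 + 1)) :
    ((proj ι t f hbpf).stalkMap x).hom
        (((ProjSpace.P (d + 1) k).presheaf.germ (ProjSpace.U j) _ hxP).hom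
          (ProjSpace.sec j (Segre.frac k j a))) =
      (X.presheaf.germ _ x hxU).hom (lsRatio (formVec ι t) j a) := by
  set G := linearSystem (formVec ι t) (isDefinedAt_formVec ι hbpf) with hG
  rw [Scheme.Hom.germ_stalkMap_apply]
  change (X.presheaf.germ (G.toProj f ⁻¹ᵁ ProjSpace.U j) x hxP).hom
      ((G.toProj f).app (ProjSpace.U j) (ProjSpace.sec j (Segre.frac k j a))) = _
  rw [GeneratingSections.app_sec, GeneratingSections.chartRingHom_frac,
    GeneratingSections.topIso_hom_res (le_of_eq (G.toProj_preimage_U f j))]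
  exact TopCat.Presheaf.germ_res_apply X.presheaf _ x _ _

/-- **`(tₐ/t_j)_x · (t_j/x_h)_x = (tₐ/x_h)_x` in `𝒪_{X,x}`** (checked in `K(X)`). [folklore] -/
theorem germ_lsRatio_mul_germ_linSec {x : X} {h : Fin (N + 1)} (hx : x ∈ chart ι h)
    {j : Fin (d + 1 + 1)} (hxU : x ∈ lsChart (formVec ι t) j) (a : Fin (d + 1 + 1)) :
    (X.presheaf.germ _ x hxU).hom (lsRatio (formVec ι t) j a) *
        (X.presheaf.germ (chart ι h) x hx).hom (linSec ι h (t j)) =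
      (X.presheaf.germ (chart ι h) x hx).hom (linSec ι h (t a)) := by
  have hj0 : formVec ι t j ≠ 0 := ne_zero_of_mem_lsChart _ hxU
  have hne : genericPoint X ∈ chart ι h := genericPoint_mem_of_mem hx
  apply toFunctionField_injective x
  rw [map_mul]
  change toFunctionField x (X.presheaf.germ _ x hxU (lsRatio (formVec ι t) j a)) *
      toFunctionField x (X.presheaf.germ _ x hx (linSec ι h (t j))) =
    toFunctionField x (X.presheaf.germ _ x hx (linSec ι h (t a)))
  rw [← ofSection_eq_toFunctionField hxU, ← ofSection_eq_toFunctionField hx,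
    ← ofSection_eq_toFunctionField hx, ofSection_lsRatio _ hj0 a, ofSection_linSec ι hne,
    ofSection_linSec ι hne, formVec_apply, formVec_apply,
    div_mul_div_cancel₀ (by simpa using hj0)]

/-! ## `𝔪_vertex · 𝒪_{X,x}` -/

/-- **For `π(x) = p` the vertex: `𝔪_p · 𝒪_{X,x} = (t₀, …, t_d)_x`.** The maximal ideal of
`𝒪_{ℙ^{d+1}, p}` is generated by the `yₐ/y_{d+1}` (`DeJong1996.maximalIdeal_stalk_vertex`), which
pull back to the ratios `tₐ/t_{d+1}`, associated in `𝒪_{X,x}` to the germs of the forms `tₐ`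
read in any chart. [cite: DeJong1996, Lemma 4.11 (proof), p. 68] -/
theorem map_maximalIdeal_proj {x : X} (hx : proj ι t f hbpf x = vertex d k) :
    (maximalIdeal ((ProjSpace.P (d + 1) k).presheaf.stalk (proj ι t f hbpf x))).map
        ((proj ι t f hbpf).stalkMap x).hom = cutIdeal ι x (tInit t) := by
  have hxU := mem_lsChart_last_of_proj_eq_vertex ι t f hbpf hx
  obtain ⟨h, hxh⟩ := exists_mem_chart ι x
  -- generators of `𝔪_vertex`, transported to the point `π x = vertex`
  have key : ∀ (p : ProjSpace.P (d + 1) k) (_ : p = vertex d k)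
      (hpU : p ∈ (lastChart d k : (ProjSpace.P (d + 1) k).Opens)),
      maximalIdeal ((ProjSpace.P (d + 1) k).presheaf.stalk p) =
        Ideal.span (Set.range fun a : Fin (d + 1) =>
          ((ProjSpace.P (d + 1) k).presheaf.germ (lastChart d k) p hpU).hom (vertexSection d k a)) := by
    rintro p rfl hpU
    exact maximalIdeal_stalk_vertex d k
  have hxP : proj ι t f hbpf x ∈ (lastChart d k : (ProjSpace.P (d + 1) k).Opens) := by
    rw [hx]; exact vertex_mem_lastChart d k
  have hsec : ∀ a : Fin (d + 1), vertexSection d k a =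
      ProjSpace.sec (Fin.last (d + 1)) (Segre.frac k (Fin.last (d + 1)) (Fin.castSucc a)) := fun a => by
    rw [vertexSection_eq, ProjSpace.sec_eq_awayToSection, ← PointBlowup.frac_succAbove_eq_chartGen,
      Fin.succAbove_last_apply]
  rw [key _ hx hxP, Ideal.map_span, ← Set.range_comp]
  have hgen : (Set.range ((((proj ι t f hbpf).stalkMap x).hom) ∘ fun a : Fin (d + 1) =>
      ((ProjSpace.P (d + 1) k).presheaf.germ (lastChart d k) _ hxP).hom (vertexSection d k a))) =
      Set.range fun a : Fin (d + 1) =>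
        (X.presheaf.germ _ x hxU).hom (lsRatio (formVec ι t) (Fin.last (d + 1)) (Fin.castSucc a)) := by
    congr 1
    funext a
    simp only [Function.comp_apply, hsec]
    exact stalkMap_proj_germ_sec ι t f hbpf (Fin.last (d + 1)) hxP hxU (Fin.castSucc a)
  rw [hgen, cutIdeal_eq_span_of_mem ι x (tInit t) hxh]
  -- the two generating families differ by the unit `(t_{d+1}/x_h)_x`
  set u := (X.presheaf.germ (chart ι h) x hxh).hom (linSec ι h (t (Fin.last (d + 1)))) with hu
  have hunit : IsUnit u :=
    not_not.mp ((mem_hyp_iff_not_isUnit_germ ι hxh _).not.mp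
      (notMem_hyp_last_of_proj_eq_vertex ι t f hbpf hx))
  have hrel : ∀ a : Fin (d + 1),
      (X.presheaf.germ _ x hxU).hom (lsRatio (formVec ι t) (Fin.last (d + 1)) (Fin.castSucc a)) * u =
        (X.presheaf.germ (chart ι h) x hxh).hom (linSec ι h (tInit t a)) := fun a =>
    germ_lsRatio_mul_germ_linSec ι t hxh hxU (Fin.castSucc a)
  apply le_antisymm
  · refine Ideal.span_le.mpr (Set.range_subset_iff.mpr fun a => ?_)
    have : (X.presheaf.germ _ x hxU).hom (lsRatio (formVec ι t) (Fin.last (d + 1)) (Fin.castSucc a)) =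
        (X.presheaf.germ (chart ι h) x hxh).hom (linSec ι h (tInit t a)) * ↑hunit.unit⁻¹ := by
      rw [← hrel a, mul_assoc, IsUnit.mul_val_inv, mul_one]
    rw [SetLike.mem_coe, this]
    exact Ideal.mul_mem_right _ _ (Ideal.subset_span ⟨a, rfl⟩)
  · refine Ideal.span_le.mpr (Set.range_subset_iff.mpr fun a => ?_)
    rw [SetLike.mem_coe, ← hrel a]
    exact Ideal.mul_mem_right _ _ (Ideal.subset_span ⟨a, rfl⟩)

/-! ## Reduced fibre and étaleness over the vertex -/

/-- **The fibre `π⁻¹(vertex)` is reduced as soon as `(t₀, …, t_d)_x = 𝔪_x` at every point over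
the vertex**: the local rings of the fibre are `𝒪_{X,x}/𝔪_p𝒪_{X,x} = 𝒪_{X,x}/𝔪_x = κ(x)`.
[cite: DeJong1996, Lemma 4.11 (proof), p. 68] -/
theorem isReduced_fiber_vertex
    (hunr : ∀ x : X, proj ι t f hbpf x = vertex d k →
      cutIdeal ι x (tInit t) = maximalIdeal (X.presheaf.stalk x)) :
    IsReduced (↑((proj ι t f hbpf).fiber (vertex d k)) : Scheme.{u}) := by
  set π := proj ι t f hbpf with hπ
  haveI : ∀ z : ↥(π.fiber (vertex d k)), _root_.IsReduced ((π.fiber (vertex d k)).presheaf.stalk z) := by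
    intro z
    set x := π.fiberι (vertex d k) z with hxz
    have hxv : π x = vertex d k := apply_fiberι π (vertex d k) z
    obtain ⟨e⟩ := nonempty_stalkFiber_ringEquiv π (vertex d k) z
    have hI : (maximalIdeal ((ProjSpace.P (d + 1) k).presheaf.stalk (π x))).map (π.stalkMap x).hom =
        maximalIdeal (X.presheaf.stalk x) := by
      rw [hπ, map_maximalIdeal_proj ι t f hbpf hxv]
      exact hunr x hxv
    let e' := e.trans (Ideal.quotEquivOfEq hI)
    haveI : _root_.IsReduced (X.presheaf.stalk x ⧸ maximalIdeal (X.presheaf.stalk x)) :=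
      inferInstance
    exact isReduced_of_injective e'.toRingHom e'.injective
  exact isReduced_of_isReduced_stalk _

/-- **`π = (t₀ : … : t_{d+1})` is étale over a neighbourhood of the vertex** as soon as
`(t₀, …, t_d)_x = 𝔪_x` at every point `x` over the vertex (`k` algebraically closed, `X`
integral and proper of dimension `d + 1`): the clause "`p ∉ B`" of
`DeJong1996.Lemma411Projection`, by the sibling's
`DeJong1996.exists_etale_morphismRestrict_vertex_of_isReduced_fiber`.
[cite: DeJong1996, Lemma 4.11 (proof), p. 68] -/
theorem exists_etale_morphismRestrict_proj_vertex [IsAlgClosed k] [IsClosedImmersion ι]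
    [IsProper f] (hdim : topologicalKrullDim X = (d + 1 : ℕ))
    (hunr : ∀ x : X, proj ι t f hbpf x = vertex d k →
      cutIdeal ι x (tInit t) = maximalIdeal (X.presheaf.stalk x)) :
    ∃ V : (ProjSpace.P (d + 1) k).Opens, vertex d k ∈ V ∧ Etale (proj ι t f hbpf ∣_ V) := by
  haveI := isFinite_proj ι t f hbpf
  haveI : LocallyOfFiniteType (proj ι t f hbpf ≫ Segre.toSpec (Fin (d + 1 + 1)) k) := by
    rw [proj_toSpec]; infer_instance
  haveI := isReduced_fiber_vertex ι t f hbpf hunr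
  exact exists_etale_morphismRestrict_vertex_of_isReduced_fiber d k (proj ι t f hbpf) hdim

end LinSec

end Literature.AlgebraicGeometry.Resolution

end
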